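import Literature.Analysis.FluidPDE.NSEssEndpointProofs
import Literature.Analysis.FluidPDE.CKNEpsilonRegularity
import HarnessLib

/-!
# The endpoint criterion `ess_endpoint`: Lemarié-Rieusset's ε-regularity in place of ESS Lemma 2.2

Analysis/FluidPDE proof file in the decomposition of **ns.S08**
`Literature.Analysis.FluidPDE.ess_endpoint` (Escauriaza–Seregin–Šverák 2003, Thm. 1.3). The
accepted assembly `ess_endpoint_of_ESS_theory` (`FluidPDE/NSEssEndpointProofs`) consumes, among
its six named facts, the ESS-specific ε-regularity lemma `ess_epsilon_regularity'` (ESS 2003,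
Lemma 2.2 over the corrected Def. 2.1: smallness of `∫_Q (|U|³ + |P|^{3/2})` for an ESS-suitable
pair gives a Hölder continuous representative bounded by `c₀₁` on `Q̄(1/2)`). Downstream only the
*bound* is used (`ess_sup_bound_of_scaled` takes the rescaled bound
`(νR)⁻² ∫_{Q_ν(z₀,R)} (|u|³ + |p|^{3/2}) < ε₀ ⇒ |u| ≤ c₀ ν / R` a.e. on `Q_ν(z₀, R/2)` as its
hypothesis), and that bound is exactly the printed one-scale ε-regularity criterion of
Caffarelli–Kohn–Nirenberg in Lemarié-Rieusset's form, already vendored for **ns.S12** as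
`lemarieRieusset_epsilon_regularity` (Lemarié-Rieusset 2016, Thm. 14.4, `FluidPDE/CKNEpsilonRegularity`).
This file re-threads the assembly through that shared fact:

* `localEnergy_ckn_of_L3infty` — for pairs with ESS (1.15)–(1.16) on the unit cylinder
  `Q = (-1, 0) × B(0, 1)` the local energy inequality holds in the distributional
  (Caffarelli–Kohn–Nirenberg / Lemarié-Rieusset (14.16)) form
  `2 ∫∫ |∇v|² φ ≤ ∫∫ (|v|² (∂ₜφ + Δφ) + (|v|² + 2p) v·∇φ)` for every nonnegative `φ ∈ 𝒟(Q)`,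
  with the given weak gradient: the sliced inequality (2.4) of
  `ae_localEnergyInequality_of_L3infty` (`FluidPDE/NSSuitableESSProofs`) at a time `t` beyond
  the support of `φ`, followed by Fubini;
* `ess_epsilon_bound_scaled_LR` — the rescaled bound from `lemarieRieusset_epsilon_regularity`
  (viscosity-normalising rescaling `IsL3inftyLocalPair.stRescale`, the unit cylinder being a
  domain, `f = 0`, `q = 3`, `λ = ε₀`, `r₀ = 1`);
* `ess_sup_bound_of_LR`, `ess_endpoint_of_ESS_theory_LR` — ESS (3.6) and **ns.S08** from the
  named facts `ess_local_holder` (ESS Thm. 1.4), `lemarieRieusset_epsilon_regularity`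
  (Lemarié-Rieusset 2016, Thm. 14.4), `ess_associated_pressure` (ESS (3.2)–(3.4)),
  `ess_kato_L3_local` (ESS Thm. 7.4), `galdi_energy_equality` (Galdi 2018, Thm. 1.1) and
  `ladyzhenskaya_prodi_serrin` (**ns.S07**).

No statement is introduced or changed; all declarations are theorems.

## References

* L. Escauriaza, G. Seregin, V. Šverák, *`L_{3,∞}`-solutions of Navier–Stokes equations and
  backward uniqueness*, Russ. Math. Surveys 58:2 (2003), Thm. 1.3, Lemma 2.2, §3 (3.5)–(3.6).
* P. G. Lemarié-Rieusset, *The Navier–Stokes Problem in the 21st Century*, CRC Press (2016),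
  Thm. 14.4 (p. 505), Def. 13.5 (p. 462).
* L. Caffarelli, R. Kohn, L. Nirenberg, *Partial regularity of suitable weak solutions of the
  Navier–Stokes equations*, Comm. Pure Appl. Math. 35 (1982), (2.5), Proposition 1.
-/

noncomputable section

open MeasureTheory TopologicalSpace Set Function Filter Topology Metric
open scoped InnerProductSpace RealInnerProductSpace ENNReal NNReal Laplacian

namespace Literature.Analysis.FluidPDE

section CKNForm

variable {E : Type*} [NormedAddCommGroup E] [InnerProductSpace ℝ E] [FiniteDimensional ℝ E]
  [MeasurableSpace E] [BorelSpace E]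

/-- **The local energy inequality of `L_{3,∞} ∩ L₂W¹₂` distributional solutions, distributional
form** (Caffarelli–Kohn–Nirenberg 1982, (2.5); Lemarié-Rieusset 2016, Def. 13.5 / (14.16);
Escauriaza–Seregin–Šverák 2003, proof of Thm. 1.4, first paragraph). Let `dim E = 3` and let
`(v, p)` solve the Navier–Stokes system (`ν = 1`, no force) in the sense of distributions on the
unit cylinder `Q = (-1, 0) × B(0, 1)`, with `v ∈ L_{2,∞}(Q) ∩ L_{3,∞}(Q)` (sliced bounds), a weak
spatial gradient `G` with `∫∫_Q |G|² < ∞`, and `p ∈ L_{3/2}(Q)`. Then for every nonnegative test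
function `φ ∈ C_c^∞(Q)`,
`2 ∫∫ |G|² φ ≤ ∫∫ (|v|² (∂ₜφ + Δφ) + (|v|² + 2p) ⟪v, ∇φ⟫)` (iterated integrals over `ℝ` and `E`).
Proof: the sliced inequality (2.4) (`ae_localEnergyInequality_of_L3infty`) at a time `t ∈ (-1, 0)`
later than the support of `φ` (where `φ(t, ·) = 0` and the truncated cylinder `(-1, t) × B`
carries the whole support), and Fubini. [cite: CaffarelliKohnNirenberg1982, (2.5)] -/
theorem localEnergy_ckn_of_L3infty (hE : Module.finrank ℝ E = 3) {v : ℝ → E → E}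
    {p : ℝ → E → ℝ} {G : ℝ → E → E →L[ℝ] E}
    (hNS : IsDistributionalNSSolutionOn (parabolicCylinderOpens 1 ((0 : ℝ), (0 : E))) 1 0 v p)
    (h2 : ∃ C : ℝ≥0, ∀ᵐ t ∂(volume.restrict (Ioo (-1 : ℝ) 0)),
      ∫⁻ x in ball (0 : E) 1, ‖v t x‖ₑ ^ 2 ≤ C)
    (hG : HasWeakSpatialGradientOn (parabolicCylinderOpens 1 ((0 : ℝ), (0 : E))) v G)
    (hG2 : ∫⁻ z in parabolicCylinder 1 ((0 : ℝ), (0 : E)),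
      ENNReal.ofReal (frobeniusNormSq (G z.1 z.2)) < ∞)
    (hp : ∫⁻ z in parabolicCylinder 1 ((0 : ℝ), (0 : E)), ‖p z.1 z.2‖ₑ ^ (3 / 2 : ℝ) < ∞)
    (h3 : ∃ C : ℝ≥0, ∀ᵐ t ∂(volume.restrict (Ioo (-1 : ℝ) 0)),
      ∫⁻ x in ball (0 : E) 1, ‖v t x‖ₑ ^ 3 ≤ C) :
    ∀ φ : ℝ → E → ℝ, IsSpaceTimeTestOn (parabolicCylinderOpens 1 ((0 : ℝ), (0 : E))) φ →
      (∀ t x, 0 ≤ φ t x) →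
      2 * ∫ t, ∫ x, frobeniusNormSq (G t x) * φ t x ≤
        ∫ t, ∫ x, (‖v t x‖ ^ 2 * (timeDeriv φ t x + Δ (φ t) x) +
          (‖v t x‖ ^ 2 + 2 * p t x) * ⟪v t x, gradient (φ t) x⟫) := by
  intro φ hφ hφ0
  haveI : Nontrivial E := Module.nontrivial_of_finrank_pos (R := ℝ) (by rw [hE]; norm_num)
  haveI : (volume : Measure (ℝ × E)).IsAddHaarMeasure := Measure.prod.instIsAddHaarMeasure _ _
  -- ## the cylinder
  set Qo : Opens (ℝ × E) := parabolicCylinderOpens 1 ((0 : ℝ), (0 : E)) with hQo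
  have hQ : (Qo : Set (ℝ × E)) = Ioo (-1 : ℝ) 0 ×ˢ ball (0 : E) 1 := by
    rw [hQo, coe_parabolicCylinderOpens, parabolicCylinder_one_zero]
  have hQ' : parabolicCylinder 1 ((0 : ℝ), (0 : E)) = Ioo (-1 : ℝ) 0 ×ˢ ball (0 : E) 1 :=
    parabolicCylinder_one_zero
  rw [hQ'] at hG2 hp
  have hQm : MeasurableSet (Ioo (-1 : ℝ) 0 ×ˢ ball (0 : E) 1) :=
    measurableSet_Ioo.prod measurableSet_ball
  have hIfin : volume (Ioo (-1 : ℝ) 0) < ∞ := measure_Ioo_lt_top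
  -- ## the sliced local energy inequality (ESS (2.4)) for the given gradient
  set ω : Opens E := ⟨ball (0 : E) 1, isOpen_ball⟩ with hω_def
  have hω : (ω : Set E) = ball (0 : E) 1 := rfl
  have hsl := ae_localEnergyInequality_of_L3infty hE hω hNS h2 hG
    (by rw [hQ']; exact hG2) (by rw [hQ']; exact hp) h3
  -- ## space–time classes on `Q`
  set μQ : Measure (ℝ × E) := volume.restrict (Ioo (-1 : ℝ) 0 ×ˢ ball (0 : E) 1) with hμQ
  obtain ⟨C₂, h2⟩ := h2
  obtain ⟨C₃, h3⟩ := h3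
  have hvm : AEStronglyMeasurable (uncurry v) μQ := by
    have := hNS.1.aestronglyMeasurable; rwa [hQ] at this
  have hpm : AEStronglyMeasurable (uncurry p) μQ := by
    have := hNS.2.2.1.aestronglyMeasurable; rwa [hQ] at this
  have hGm : AEStronglyMeasurable (uncurry G) μQ := by
    have := hG.locallyIntegrableOn_grad.aestronglyMeasurable; rwa [hQ] at this
  have three_halves_ne_top : (3 / 2 : ℝ≥0∞) ≠ ∞ :=
    ENNReal.div_ne_top (by norm_num) (by norm_num)
  have three_halves_ne_zero : (3 / 2 : ℝ≥0∞) ≠ 0 :=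
    (ENNReal.div_pos (by norm_num) (by norm_num)).ne'
  have hv2Q : MemLp (uncurry v) 2 μQ :=
    memLp_of_slice_bound hIfin hvm two_ne_zero ENNReal.coe_lt_top (n := 2)
      (by exact_mod_cast h2)
  have hv3Q : MemLp (uncurry v) 3 μQ :=
    memLp_of_slice_bound hIfin hvm (by norm_num) ENNReal.coe_lt_top (n := 3)
      (by exact_mod_cast h3)
  have hpQ : MemLp (uncurry p) (3 / 2) μQ := by
    refine memLp_of_lintegral_rpow_lt_top three_halves_ne_zero three_halves_ne_top hpm ?_
    have : ((3 : ℝ≥0∞) / 2).toReal = 3 / 2 := by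
      rw [ENNReal.toReal_div]; norm_num
    rw [this]
    exact hp
  haveI hHT31 : ENNReal.HolderTriple (3 / 2) 3 1 := by
    have h := holderTriple_ofReal (a := 3 / 2) (b := 3) (c := 1) (by norm_num) (by norm_num)
      (by norm_num) (by norm_num)
    rwa [ENNReal.ofReal_ofNat, ENNReal.ofReal_div_of_pos (by norm_num), ENNReal.ofReal_ofNat,
      ENNReal.ofReal_ofNat, ENNReal.ofReal_one] at h
  -- ## the support of `φ` and a late time `t`
  have hK : IsCompact (tsupport (uncurry φ)) := hφ.hasCompactSupport
  have hKQ : tsupport (uncurry φ) ⊆ Ioo (-1 : ℝ) 0 ×ˢ ball (0 : E) 1 :=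
    hQ ▸ hφ.tsupport_subset
  obtain ⟨ε, hε, hε1, hmargin⟩ := exists_margin_of_isCompact hK hKQ
  have hsub : Ioo (-ε) (0 : ℝ) ⊆ Ioo (-1 : ℝ) 0 := Ioo_subset_Ioo (by linarith) le_rfl
  have hsl' := ae_restrict_of_ae_restrict_of_subset hsub hsl
  haveI : (ae (volume.restrict (Ioo (-ε) (0 : ℝ)))).NeBot := by
    rw [ae_neBot, Ne, Measure.restrict_eq_zero, Real.volume_Ioo]
    simp [hε]
  obtain ⟨t, ht, htI⟩ := (hsl'.and (ae_restrict_mem measurableSet_Ioo)).exists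
  have hle : Qo ≤ forwardCylinder ω (-1) := by
    intro z hz
    have hz' : z ∈ (Qo : Set (ℝ × E)) := hz
    rw [hQ] at hz'
    show z ∈ (forwardCylinder ω (-1) : Set (ℝ × E))
    rw [coe_forwardCylinder]
    exact ⟨hz'.1.1, hz'.2⟩
  have hineq := ht φ (hφ.mono hle) hφ0
  -- `φ` and all weights vanish at times `≥ -ε`, in particular at `t` and off `S`
  set S : Set (ℝ × E) := Ioo (-1 : ℝ) t ×ˢ (ω : Set E) with hS
  have hKS : tsupport (uncurry φ) ⊆ S := by
    intro z hz
    have hm := hmargin z hz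
    have hzQ := hKQ hz
    refine ⟨⟨hzQ.1.1, ?_⟩, by rw [hω]; exact hzQ.2⟩
    linarith [htI.1, hm.2.1]
  have hφt : ∀ x, φ t x = 0 := fun x => by
    refine image_eq_zero_of_notMem_tsupport (f := uncurry φ) (x := (t, x)) fun h => ?_
    have hm := hmargin _ h
    linarith [htI.1, hm.2.1]
  have hw0 : ∀ z, z ∉ tsupport (uncurry φ) →
      φ z.1 z.2 = 0 ∧ gradient (φ z.1) z.2 = 0 ∧ (Δ (φ z.1)) z.2 = 0 ∧ timeDeriv φ z.1 z.2 = 0 :=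
    fun z hz => weights_eq_zero_of_notMem_tsupport hz
  -- ## the whole-space integrands
  set F₁ : ℝ × E → ℝ := fun z => frobeniusNormSq (G z.1 z.2) * φ z.1 z.2 with hF₁
  set F₂ : ℝ × E → ℝ := fun z => ‖v z.1 z.2‖ ^ 2 * (timeDeriv φ z.1 z.2 + Δ (φ z.1) z.2) +
    (‖v z.1 z.2‖ ^ 2 + 2 * p z.1 z.2) * ⟪v z.1 z.2, gradient (φ z.1) z.2⟫ with hF₂
  have hF₁0 : ∀ z, z ∉ tsupport (uncurry φ) → F₁ z = 0 := fun z hz => by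
    simp only [hF₁, (hw0 z hz).1, mul_zero]
  have hF₂0 : ∀ z, z ∉ tsupport (uncurry φ) → F₂ z = 0 := fun z hz => by
    obtain ⟨-, h2', h3', h4'⟩ := hw0 z hz
    simp only [hF₂, h2', h3', h4', inner_zero_right, add_zero, mul_zero]
  -- the sliced inequality in terms of `F₁`, `F₂`
  have hL0 : ∫ x in (ω : Set E), φ t x * ‖v t x‖ ^ 2 = 0 := by
    simp only [hφt, zero_mul, integral_zero]
  have hL1 : ∫ z in S, φ z.1 z.2 * frobeniusNormSq (G z.1 z.2) = ∫ z, F₁ z := by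
    rw [setIntegral_eq_integral_of_forall_compl_eq_zero fun z hz => ?_]
    · exact integral_congr_ae (Eventually.of_forall fun z => mul_comm _ _)
    · have hz' : z ∉ tsupport (uncurry φ) := fun h => hz (hKS h)
      rw [(hw0 z hz').1, zero_mul]
  have hR1 : ∫ z in S, (‖v z.1 z.2‖ ^ 2 * ((1 : ℝ) * (Δ (φ z.1)) z.2 + timeDeriv φ z.1 z.2) +
      ⟪v z.1 z.2, gradient (φ z.1) z.2⟫ * (‖v z.1 z.2‖ ^ 2 + 2 * p z.1 z.2)) = ∫ z, F₂ z := by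
    rw [setIntegral_eq_integral_of_forall_compl_eq_zero fun z hz => ?_]
    · exact integral_congr_ae (Eventually.of_forall fun z => by simp only [hF₂]; ring)
    · have hz' : z ∉ tsupport (uncurry φ) := fun h => hz (hKS h)
      obtain ⟨-, h2', h3', h4'⟩ := hw0 z hz'
      simp only [h2', h3', h4', inner_zero_right, mul_zero, add_zero, zero_mul]
  have hmain : 2 * ∫ z, F₁ z ≤ ∫ z, F₂ z := by
    have := hineq
    rw [hL0, hL1, hR1, zero_add] at this
    linarith
  -- ## integrability on the whole space (the integrands live on `Q`)
  have cφ : Continuous (uncurry φ) := hφ.contDiff.continuous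
  have sφ : IsSmoothSpaceTimeOn univ φ := hφ.isSmoothSpaceTimeOn univ
  have cgφ : Continuous (uncurry fun s y => gradient (φ s) y) :=
    (sφ.gradient uniqueDiffOn_univ).continuous_uncurry
  have cΔφ : Continuous (uncurry fun s y => (Δ (φ s)) y) :=
    (sφ.laplacian uniqueDiffOn_univ).continuous_uncurry
  have cTφ : Continuous (uncurry (timeDeriv φ)) := hφ.continuous_timeDeriv
  set wΔ : ℝ × E → ℝ := fun z => timeDeriv φ z.1 z.2 + (Δ (φ z.1)) z.2 with hwΔ
  set wφ : ℝ × E → ℝ := fun z => φ z.1 z.2 with hwφ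
  set wg : ℝ × E → E →L[ℝ] ℝ := fun z => innerSL ℝ (gradient (φ z.1) z.2) with hwg
  have cwΔ : Continuous wΔ := cTφ.add cΔφ
  have cwg : Continuous wg := (innerSL ℝ).continuous.comp cgφ
  have hsuppφ : HasCompactSupport (uncurry φ) := hφ.hasCompactSupport
  obtain ⟨CΔ, hCΔ⟩ := cwΔ.bounded_above_of_compact_support
    (hsuppφ.mono' fun z hz => by
      by_contra h
      obtain ⟨-, -, h3', h4'⟩ := hw0 z h
      exact hz (by simp only [hwΔ, h3', h4', add_zero]))
  obtain ⟨Cφ, hCφ⟩ := cφ.bounded_above_of_compact_support hsuppφ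
  obtain ⟨Cg, hCg⟩ := cwg.bounded_above_of_compact_support
    (hsuppφ.mono' fun z hz => by
      by_contra h
      exact hz (by simp only [hwg, (hw0 z h).2.1, map_zero]))
  have mwΔ : AEStronglyMeasurable wΔ μQ := cwΔ.aestronglyMeasurable
  have mwφ : AEStronglyMeasurable wφ μQ := cφ.aestronglyMeasurable
  have mwg : AEStronglyMeasurable wg μQ := cwg.aestronglyMeasurable
  have bwΔ : ∀ᵐ z ∂μQ, ‖wΔ z‖ ≤ CΔ := Eventually.of_forall hCΔ
  have bwφ : ∀ᵐ z ∂μQ, ‖wφ z‖ ≤ Cφ := Eventually.of_forall hCφ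
  have bwg : ∀ᵐ z ∂μQ, ‖wg z‖ ≤ Cg := Eventually.of_forall hCg
  -- `F₁` on `Q`
  have iFr : Integrable (fun z : ℝ × E => frobeniusNormSq (G z.1 z.2)) μQ := by
    refine ⟨LerayHopfProofs.continuous_frobeniusNormSq.comp_aestronglyMeasurable hGm, ?_⟩
    refine (hasFiniteIntegral_iff_enorm.2 ?_)
    refine lt_of_le_of_lt (lintegral_mono fun z => ?_) hG2
    rw [Real.enorm_eq_ofReal (frobeniusNormSq_nonneg _)]
  have iF₁Q : Integrable F₁ μQ := by
    have := iFr.bdd_mul mwφ bwφ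
    refine this.congr (Eventually.of_forall fun z => ?_)
    simp only [hwφ, hF₁, mul_comm]
  -- `F₂` on `Q`
  set βs : ℝ →L[ℝ] E →L[ℝ] E := ContinuousLinearMap.lsmul ℝ ℝ with hβs
  have iT1 : Integrable (fun z : ℝ × E => ‖v z.1 z.2‖ ^ 2 * wΔ z) μQ := by
    have := (hv2Q.integrable_norm_pow two_ne_zero).bdd_mul mwΔ bwΔ
    refine this.congr (Eventually.of_forall fun z => ?_)
    simp only [uncurry, mul_comm]
  have hsq : MemLp (fun z : ℝ × E => ‖uncurry v z‖ ^ 2) (3 / 2) μQ := by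
    haveI hHT33 : ENNReal.HolderTriple 3 3 (3 / 2) := by
      have h := holderTriple_ofReal (a := 3) (b := 3) (c := 3 / 2) (by norm_num) (by norm_num)
        (by norm_num) (by norm_num)
      rwa [ENNReal.ofReal_ofNat, ENNReal.ofReal_div_of_pos (by norm_num), ENNReal.ofReal_ofNat,
        ENNReal.ofReal_ofNat] at h
    have := memLp_bilin (p := 3) (q := 3) (r := 3 / 2) (innerSL ℝ (E := E)) hv3Q hv3Q
    refine this.ae_eq (Eventually.of_forall fun z => ?_)
    show ⟪uncurry v z, uncurry v z⟫ = ‖uncurry v z‖ ^ 2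
    exact real_inner_self_eq_norm_sq _
  have iT2 : Integrable
      (fun z : ℝ × E => ‖v z.1 z.2‖ ^ 2 * ⟪v z.1 z.2, gradient (φ z.1) z.2⟫) μQ := by
    have := integrable_clm_bilin_of_memLp (p := 3 / 2) (q := 3) βs hsq hv3Q mwg bwg
    refine this.congr (Eventually.of_forall fun z => ?_)
    simp only [hwg, hβs, innerSL_apply_apply, ContinuousLinearMap.lsmul_apply,
      real_inner_smul_right, uncurry, real_inner_comm]
  have iT3 : Integrable
      (fun z : ℝ × E => p z.1 z.2 * ⟪v z.1 z.2, gradient (φ z.1) z.2⟫) μQ := by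
    have := integrable_clm_bilin_of_memLp (p := 3 / 2) (q := 3) βs hpQ hv3Q mwg bwg
    refine this.congr (Eventually.of_forall fun z => ?_)
    simp only [hwg, hβs, innerSL_apply_apply, ContinuousLinearMap.lsmul_apply,
      real_inner_smul_right, uncurry, real_inner_comm]
  have iF₂Q : Integrable F₂ μQ := by
    have := (iT1.add (iT2.add (iT3.const_mul 2)))
    refine this.congr (Eventually.of_forall fun z => ?_)
    simp only [hF₂, hwΔ, Pi.add_apply]
    ring
  -- whole space
  have hsupp₁ : support F₁ ⊆ Ioo (-1 : ℝ) 0 ×ˢ ball (0 : E) 1 := fun z hz =>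
    hKQ (by by_contra h; exact hz (hF₁0 z h))
  have hsupp₂ : support F₂ ⊆ Ioo (-1 : ℝ) 0 ×ˢ ball (0 : E) 1 := fun z hz =>
    hKQ (by by_contra h; exact hz (hF₂0 z h))
  have iF₁ : Integrable F₁ (volume : Measure (ℝ × E)) :=
    (integrableOn_iff_integrable_of_support_subset hsupp₁).1 iF₁Q
  have iF₂ : Integrable F₂ (volume : Measure (ℝ × E)) :=
    (integrableOn_iff_integrable_of_support_subset hsupp₂).1 iF₂Q
  -- ## Fubini
  have e₁ : ∫ z, F₁ z = ∫ s, ∫ y, F₁ (s, y) := by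
    rw [Measure.volume_eq_prod] at iF₁ ⊢
    exact integral_prod F₁ iF₁
  have e₂ : ∫ z, F₂ z = ∫ s, ∫ y, F₂ (s, y) := by
    rw [Measure.volume_eq_prod] at iF₂ ⊢
    exact integral_prod F₂ iF₂
  rw [e₁, e₂] at hmain
  simpa only [hF₁, hF₂] using hmain

end CKNForm

/-! ### The rescaled ε-regularity bound from Lemarié-Rieusset's Thm. 14.4, and the assemblies -/

/-- **The rescaled ε-regularity bound of ESS §3 from the Caffarelli–Kohn–Nirenberg criterion in
Lemarié-Rieusset's form** (Lemarié-Rieusset 2016, Thm. 14.4 with `f = 0`, `q = 3`, `ν = 1`,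
`r₀ = 1`, `λ = ε₀`; Escauriaza–Seregin–Šverák 2003, §3, proof of (3.6), where Lemma 2.2 serves
the same purpose): there are `ε₀, c₀ > 0` such that for every pair `(u, p)` with the hypotheses
(1.15)–(1.16) of ESS Thm. 1.4 on a viscous cylinder `Q_ν(z₀, R)` (`IsL3inftyLocalPair`) and
`(νR)⁻² ∫_{Q_ν(z₀,R)} (|u|³ + |p|^{3/2}) < ε₀`, one has `|u| ≤ c₀ ν / R` a.e. on `Q_ν(z₀, R/2)` —
literally the hypothesis of the accepted `ess_sup_bound_of_scaled`. Proof: the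
viscosity-normalising rescaling `IsL3inftyLocalPair.stRescale` puts the pair on the unit cylinder
with `ν = 1`, where it is a distributional solution in the energy class with `p ∈ L^{3/2}`
satisfying the local energy inequality in distributional form (`localEnergy_ckn_of_L3infty`);
the unit cylinder is a domain, so Thm. 14.4 bounds the rescaled velocity by `C₀ ε₀` a.e. on
`Q(1/2)` (constants `ε₀³`, `C₀ ε₀`), and the bound is transported back by the affine change of
variables. Real proof. [cite: LemarieRieusset2016, Thm. 14.4 p. 505] -/
theorem ess_epsilon_bound_scaled_LR (hε : lemarieRieusset_epsilon_regularity) :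
    ∃ ε₀ c₀ : ℝ, 0 < ε₀ ∧ 0 < c₀ ∧ ∀ {ν R t₀ : ℝ} {x₀ : EuclideanSpace ℝ (Fin 3)}
      {u : ℝ → EuclideanSpace ℝ (Fin 3) → EuclideanSpace ℝ (Fin 3)}
      {p : ℝ → EuclideanSpace ℝ (Fin 3) → ℝ},
      0 < ν → 0 < R → IsL3inftyLocalPair ν R (t₀, x₀) u p →
      ENNReal.ofReal ((ν ^ 2 * R ^ 2)⁻¹) *
          ∫⁻ z in FluidPDE.viscousCylinder ν R (t₀, x₀),
            (‖u z.1 z.2‖ₑ ^ 3 + ‖p z.1 z.2‖ₑ ^ (3 / 2 : ℝ)) < ENNReal.ofReal ε₀ →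
      ∀ᵐ z ∂(volume.restrict (FluidPDE.viscousCylinder ν (R / 2) (t₀, x₀))),
        ‖u z.1 z.2‖ ≤ c₀ * ν / R := by
  obtain ⟨ε₀, C₀, hε₀, hC₀, H⟩ := hε 1 3 one_pos (by norm_num)
  refine ⟨ε₀ ^ 3, C₀ * ε₀, by positivity, by positivity, ?_⟩
  intro ν R t₀ x₀ u p hν hR h hsmall
  have hα : 0 < R / ν := by positivity
  have hβ : 0 < R ^ 2 / ν := by positivity
  obtain ⟨h1, h2, ⟨G, hGw, hG2⟩, h4, h5⟩ :=
    (IsL3inftyLocalPair.unit_iff).1 (h.stRescale hν hR)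
  rw [← lintegral_cubic_add_pressure_stRescale hν hR t₀ x₀ u p] at hsmall
  set w : ℝ → EuclideanSpace ℝ (Fin 3) → EuclideanSpace ℝ (Fin 3) :=
    (R / ν) • FluidPDE.stPull (R ^ 2 / ν) R t₀ x₀ u with hw
  set π : ℝ → EuclideanSpace ℝ (Fin 3) → ℝ :=
    (R / ν) ^ 2 • FluidPDE.stPull (R ^ 2 / ν) R t₀ x₀ p with hπ
  set Qo : Opens (ℝ × EuclideanSpace ℝ (Fin 3)) :=
    FluidPDE.parabolicCylinderOpens 1 ((0 : ℝ), (0 : EuclideanSpace ℝ (Fin 3))) with hQo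
  have hQ : (Qo : Set (ℝ × EuclideanSpace ℝ (Fin 3))) =
      Ioo (-1 : ℝ) 0 ×ˢ ball (0 : EuclideanSpace ℝ (Fin 3)) 1 := by
    rw [hQo, FluidPDE.coe_parabolicCylinderOpens, FluidPDE.parabolicCylinder_one_zero]
  -- ## the hypotheses of Thm. 14.4 for the rescaled pair on the unit cylinder
  have hconn : IsConnected (Qo : Set (ℝ × EuclideanSpace ℝ (Fin 3))) := by
    rw [hQ]
    refine ⟨⟨((-1 / 2 : ℝ), (0 : EuclideanSpace ℝ (Fin 3))), ⟨by norm_num, by norm_num⟩,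
      by simp⟩, ((convex_Ioo _ _).prod (convex_ball _ _)).isPreconnected⟩
  have hL2 : ∃ C : ℝ≥0, ∀ᵐ t : ℝ,
      ∫⁻ x, (Qo : Set (ℝ × EuclideanSpace ℝ (Fin 3))).indicator
        (fun z : ℝ × EuclideanSpace ℝ (Fin 3) => ‖w z.1 z.2‖ₑ ^ 2) (t, x) ≤ C := by
    obtain ⟨C, hC⟩ := h2
    refine ⟨C, ?_⟩
    have hC' := (ae_restrict_iff' (measurableSet_Ioo : MeasurableSet (Ioo (-1 : ℝ) 0))).1 hC
    filter_upwards [hC'] with t ht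
    by_cases htI : t ∈ Ioo (-1 : ℝ) 0
    · refine le_trans (le_of_eq ?_) (ht htI)
      rw [← lintegral_indicator measurableSet_ball]
      refine lintegral_congr fun x => ?_
      rw [hQ]
      by_cases hx : x ∈ ball (0 : EuclideanSpace ℝ (Fin 3)) 1
      · rw [indicator_of_mem (show ((t, x) : ℝ × EuclideanSpace ℝ (Fin 3)) ∈
          Ioo (-1 : ℝ) 0 ×ˢ ball (0 : EuclideanSpace ℝ (Fin 3)) 1 from ⟨htI, hx⟩),
          indicator_of_mem hx]
      · rw [indicator_of_notMem (fun h : ((t, x) : ℝ × EuclideanSpace ℝ (Fin 3)) ∈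
          Ioo (-1 : ℝ) 0 ×ˢ ball (0 : EuclideanSpace ℝ (Fin 3)) 1 => hx h.2),
          indicator_of_notMem hx]
    · have h0 : ∀ x : EuclideanSpace ℝ (Fin 3),
          (Qo : Set (ℝ × EuclideanSpace ℝ (Fin 3))).indicator
            (fun z : ℝ × EuclideanSpace ℝ (Fin 3) => ‖w z.1 z.2‖ₑ ^ 2) (t, x) = 0 :=
        fun x => indicator_of_notMem (fun h => htI (by rw [hQ] at h; exact h.1)) _
      simp only [h0, lintegral_zero, zero_le]
  have hLE : ∀ φ : ℝ → EuclideanSpace ℝ (Fin 3) → ℝ, IsSpaceTimeTestOn Qo φ →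
      (∀ t x, 0 ≤ φ t x) →
      2 * (1 : ℝ) * ∫ t, ∫ x, frobeniusNormSq (G t x) * φ t x ≤
        ∫ t, ∫ x, (‖w t x‖ ^ 2 * (timeDeriv φ t x + 1 * Δ (φ t) x) +
          (‖w t x‖ ^ 2 + 2 * π t x) * ⟪w t x, gradient (φ t) x⟫ +
          2 * ⟪(0 : ℝ → EuclideanSpace ℝ (Fin 3) → EuclideanSpace ℝ (Fin 3)) t x, w t x⟫ *
            φ t x) := by
    intro φ hφ hφ0
    have := localEnergy_ckn_of_L3infty finrank_euclideanSpace_fin_three h1 h2 hGw hG2 h4 h5 φ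
      hφ hφ0
    simpa only [mul_one, one_mul, Pi.zero_apply, inner_zero_left, zero_mul, mul_zero, add_zero]
      using this
  have hsmall' :
      ∫⁻ z in FluidPDE.parabolicCylinder 1 ((0 : ℝ), (0 : EuclideanSpace ℝ (Fin 3))),
        (‖w z.1 z.2‖ₑ ^ (3 : ℕ) + ‖π z.1 z.2‖ₑ ^ (3 / 2 : ℝ)) ≤
      ENNReal.ofReal (ε₀ ^ 3 * 1 ^ 2) := by
    rw [one_pow, mul_one]
    exact hsmall.le
  have h0 : ∀ z : ℝ × EuclideanSpace ℝ (Fin 3),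
      ‖(0 : ℝ → EuclideanSpace ℝ (Fin 3) → EuclideanSpace ℝ (Fin 3)) z.1 z.2‖ₑ ^ (3 : ℝ) = 0 :=
    fun z => by
    rw [Pi.zero_apply, Pi.zero_apply, enorm_zero, ENNReal.zero_rpow_of_pos (by norm_num)]
  have key := H Qo 0 w π G hconn hL2 hGw hG2 h4 MemLp.zero' h1 hLE
    ((0 : ℝ), (0 : EuclideanSpace ℝ (Fin 3))) 1 ε₀ one_pos Subset.rfl hε₀.le le_rfl hsmall'
    (by simp only [h0, lintegral_zero, zero_le])
  -- ## transport back to `Q_ν(z₀, R/2)`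
  set Q₂ := FluidPDE.parabolicCylinder (1 / 2) ((0 : ℝ), (0 : EuclideanSpace ℝ (Fin 3)))
    with hQ₂
  have hae' : ∀ᵐ z ∂(volume.restrict Q₂),
      ‖(R / ν) • u (FluidPDE.stAffine (R ^ 2 / ν) R t₀ x₀ z).1
        (FluidPDE.stAffine (R ^ 2 / ν) R t₀ x₀ z).2‖ ≤ C₀ * ε₀ := by
    filter_upwards [key] with z hz
    have e : w z.1 z.2 = (R / ν) • u (FluidPDE.stAffine (R ^ 2 / ν) R t₀ x₀ z).1
        (FluidPDE.stAffine (R ^ 2 / ν) R t₀ x₀ z).2 := rfl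
    rw [← e]
    simpa only [div_one] using hz
  rw [hQ₂, ← stAffine_preimage_viscousCylinder_half hν hR t₀ x₀] at hae'
  have h6 := FluidPDE.ae_restrict_of_ae_restrict_preimage_stAffine hβ hR t₀ x₀
    (P := fun z => ‖(R / ν) • u z.1 z.2‖ ≤ C₀ * ε₀) hae'
  filter_upwards [h6] with z hz
  rw [norm_smul, Real.norm_eq_abs, abs_of_pos hα] at hz
  rw [le_div_iff₀ hR]
  calc ‖u z.1 z.2‖ * R = ν * (R / ν * ‖u z.1 z.2‖) := by field_simp
    _ ≤ ν * (C₀ * ε₀) := by gcongr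
    _ = C₀ * ε₀ * ν := mul_comm _ _

/-- **ESS (3.6) from Theorem 1.4, the Caffarelli–Kohn–Nirenberg criterion and the associated
pressure** (Escauriaza–Seregin–Šverák 2003, §3, proof of Thm. 1.3, (3.5)–(3.6)): as the accepted
`ess_sup_bound_of'`, with the rescaled ε-regularity bound supplied by Lemarié-Rieusset 2016,
Thm. 14.4 (`ess_epsilon_bound_scaled_LR`) instead of ESS Lemma 2.2. Real proof. [cite: EscauriazaSereginSverak2003, §3 (3.5)–(3.6)] -/
theorem ess_sup_bound_of_LR (hLH : ess_local_holder) (hε : lemarieRieusset_epsilon_regularity)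
    (hP : ess_associated_pressure) : ess_sup_bound :=
  ess_sup_bound_of_scaled hLH (ess_epsilon_bound_scaled_LR hε) hP

/-- **`ess_endpoint` from ESS Thm. 1.4, the Caffarelli–Kohn–Nirenberg ε-regularity criterion and
four classical facts** (Escauriaza–Seregin–Šverák 2003, Thm. 1.3 with §3): the endpoint criterion
**ns.S08** follows from `ess_local_holder` (ESS Thm. 1.4), `lemarieRieusset_epsilon_regularity`
(Lemarié-Rieusset 2016, Thm. 14.4 — the ε-regularity criterion shared with **ns.S12**),
`ess_associated_pressure` (ESS (3.2)–(3.4)), `ess_kato_L3_local` (ESS Thm. 7.4),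
`galdi_energy_equality` (Galdi 2018, Thm. 1.1) and `ladyzhenskaya_prodi_serrin` (**ns.S07**), the
suitability of `L_{3,∞}` pairs and weak–strong uniqueness being theorems
(`ae_localEnergyInequality_of_L3infty`, `serrin_weak_strong_uniqueness_holds`). Real proof. [cite: EscauriazaSereginSverak2003, Thm. 1.3] -/
theorem ess_endpoint_of_ESS_theory_LR (hLH : ess_local_holder)
    (hε : lemarieRieusset_epsilon_regularity) (hP : ess_associated_pressure)
    (hK : ess_kato_L3_local) (hG : galdi_energy_equality) (hLPS : ladyzhenskaya_prodi_serrin) :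
    ess_endpoint :=
  ess_endpoint_of_sup_bound_of_kato (ess_sup_bound_of_LR hLH hε hP) hK hG hLPS

end Literature.Analysis.FluidPDE
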